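import Literature.AlgebraicGeometry.Resolution.ShannonNoetherianHullUFD
import Literature.AlgebraicGeometry.Resolution.QuadraticTransformsRegular
import Literature.AlgebraicGeometry.Resolution.RegularLocalRingsUFD
import Mathlib.GroupTheory.MonoidLocalization.UniqueFactorization
import HarnessLib

/-!
# Proof of `HeinzerEtAl2015NoetherianHullUFD` (HLOST, arXiv:1505.06445, Thm. 4.1 (1), the clause
# «`T = S[1/x]` is a UFD»): `S[1/x]` is a LOCALISATION of a member of the sequence

Topic: `Literature/AlgebraicGeometry/Resolution`. Discharges the named fact of
`ShannonNoetherianHullUFD.lean` (typed by res-type-058 for the cell `res-hironaka`, rung L, slot W4.1,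
crux `Steer` `stmt-ResolutionOfSingularities-16345`, idea-2 card 3 support statement L5 `ResonanceAlternative`;
discharge by res-L0-w41-stub-4 g4, ledger fact claim #1).

## The argument (simpler than print, and using fewer hypotheses)

Print (Thm. 4.1 (1), proof): `S[1/x]` is `R`-flat by the «isomorphism off the closed fibre» at the
non-maximal primes, hence a localisation of the UFD `R` (Heinzer–Roitman), for `x` with `xS`
`N`-primary and `i ≫ 0`.  Here: let `x ∈ R_{i₀}` have positive value, `T := S[1/x]`.  For EVERY step
`R_j → R_{j+1} = R_j[𝔪_j/x_j]_{𝔪_O}` (`j ≥ i₀`), `x ∈ 𝔪_j` gives `x/x_j ∈ R_j[𝔪_j/x_j] ⊆ S`, so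
**`1/x_j = (x/x_j)·(1/x) ∈ T`**.  Hence the set `F` of fractions `a/b` with `a, b ∈ R_{i₀}` and `1/b ∈ T`
— a subring of `T`, closed under inverting elements that are invertible in `T` — contains `R_j[𝔪_j/x_j]`
(generated by `R_j` and the `y/x_j`) and then `R_{j+1}` (fractions `y/z` over the chart ring with `z` a unit of
`R_{j+1}` by domination), by induction on `j`; and `1/x ∈ F`.  So `T = F`: **`T` is the localisation of the
regular local ring `R_{i₀}` at `R_{i₀} ∩ Tˣ`**, for every `i₀` with `x ∈ R_{i₀}` (no «`xS` is `N`-primary»,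
no «`dim ≥ 2`», no «`i ≫ 0`» needed for this clause), and a localisation of a UFD (Auslander–Buchsbaum, tree
`uniqueFactorizationMonoid_of_isRegularLocalRing`) is a UFD (Mathlib `UniqueFactorizationMonoid.of_isLocalization`).

Contents: (private fraction bookkeeping) · `ShannonHull.exists_frac_of_mem_member` (every later member
consists of such fractions) · `ShannonHull.exists_frac_of_mem_hull` · `ShannonHull.isLocalization_hull` («`S[1/x]` is a
localisation of `R_{i₀}`», the «Furthermore» clause of Thm. 4.1 (1) in tree form) · `HeinzerEtAl2015NoetherianHullUFD_holds`.

References: W. Heinzer, K. A. Loper, B. Olberding, H. Schoutens, M. Toeniskoetter, *Ideal theory of infinite directed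
unions of local quadratic transforms*, J. Algebra 474 (2017) 213–239 = arXiv:1505.06445, Thm. 4.1 (1) [HeinzerEtAl2015];
S. D. Cutkosky (2014), §2.1–2.2 [Cutkosky2014].
-/

noncomputable section

namespace Literature.AlgebraicGeometry.Resolution

open IsLocalRing

universe u

variable {K : Type u} [Field K]

namespace ShannonHull

variable {A T : Subring K}

/-- Elements of `A` are fractions `a/1`. [folklore] -/
private theorem frac_of_mem {z : K} (hz : z ∈ A) :
    ∃ a ∈ A, ∃ b ∈ A, b ≠ 0 ∧ b⁻¹ ∈ T ∧ z = a / b :=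
  ⟨z, hz, 1, A.one_mem, one_ne_zero, by rw [inv_one]; exact T.one_mem, (div_one z).symm⟩

/-- Sums of fractions with `T`-invertible denominators are such fractions. [folklore] -/
private theorem frac_add {z w : K} (hz : ∃ a ∈ A, ∃ b ∈ A, b ≠ 0 ∧ b⁻¹ ∈ T ∧ z = a / b)
    (hw : ∃ a ∈ A, ∃ b ∈ A, b ≠ 0 ∧ b⁻¹ ∈ T ∧ w = a / b) :
    ∃ a ∈ A, ∃ b ∈ A, b ≠ 0 ∧ b⁻¹ ∈ T ∧ z + w = a / b := by
  obtain ⟨a₁, ha₁, b₁, hb₁, hb₁0, hb₁T, rfl⟩ := hz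
  obtain ⟨a₂, ha₂, b₂, hb₂, hb₂0, hb₂T, rfl⟩ := hw
  refine ⟨a₁ * b₂ + a₂ * b₁, A.add_mem (A.mul_mem ha₁ hb₂) (A.mul_mem ha₂ hb₁), b₁ * b₂,
    A.mul_mem hb₁ hb₂, mul_ne_zero hb₁0 hb₂0, ?_, ?_⟩
  · rw [mul_inv]
    exact T.mul_mem hb₁T hb₂T
  · rw [div_add_div _ _ hb₁0 hb₂0]
    ring

/-- Negatives of such fractions are such fractions. [folklore] -/
private theorem frac_neg {z : K} (hz : ∃ a ∈ A, ∃ b ∈ A, b ≠ 0 ∧ b⁻¹ ∈ T ∧ z = a / b) :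
    ∃ a ∈ A, ∃ b ∈ A, b ≠ 0 ∧ b⁻¹ ∈ T ∧ -z = a / b := by
  obtain ⟨a, ha, b, hb, hb0, hbT, rfl⟩ := hz
  exact ⟨-a, A.neg_mem ha, b, hb, hb0, hbT, by rw [neg_div]⟩

/-- Products of such fractions are such fractions. [folklore] -/
private theorem frac_mul {z w : K} (hz : ∃ a ∈ A, ∃ b ∈ A, b ≠ 0 ∧ b⁻¹ ∈ T ∧ z = a / b)
    (hw : ∃ a ∈ A, ∃ b ∈ A, b ≠ 0 ∧ b⁻¹ ∈ T ∧ w = a / b) :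
    ∃ a ∈ A, ∃ b ∈ A, b ≠ 0 ∧ b⁻¹ ∈ T ∧ z * w = a / b := by
  obtain ⟨a₁, ha₁, b₁, hb₁, hb₁0, hb₁T, rfl⟩ := hz
  obtain ⟨a₂, ha₂, b₂, hb₂, hb₂0, hb₂T, rfl⟩ := hw
  refine ⟨a₁ * a₂, A.mul_mem ha₁ ha₂, b₁ * b₂, A.mul_mem hb₁ hb₂, mul_ne_zero hb₁0 hb₂0, ?_,
    by rw [div_mul_div_comm]⟩
  rw [mul_inv]
  exact T.mul_mem hb₁T hb₂T

/-- The INVERSE of such a fraction is one as soon as it lies in `T`. [folklore] -/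
private theorem frac_inv {z : K} (hz : ∃ a ∈ A, ∃ b ∈ A, b ≠ 0 ∧ b⁻¹ ∈ T ∧ z = a / b) (hzT : z⁻¹ ∈ T) :
    ∃ a ∈ A, ∃ b ∈ A, b ≠ 0 ∧ b⁻¹ ∈ T ∧ z⁻¹ = a / b := by
  obtain ⟨a, ha, b, hb, hb0, hbT, rfl⟩ := hz
  by_cases ha0 : a = 0
  · rw [ha0, zero_div, inv_zero]
    exact frac_of_mem A.zero_mem
  · refine ⟨b, hb, a, ha, ha0, ?_, by rw [inv_div]⟩
    have : a⁻¹ = (a / b)⁻¹ * b⁻¹ := by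
      field_simp
    rw [this]
    exact T.mul_mem hzT hbT

/-- The subring generated by a set of such fractions consists of such fractions. [folklore] -/
private theorem frac_of_mem_closure {s : Set K} (hs : ∀ z ∈ s, ∃ a ∈ A, ∃ b ∈ A, b ≠ 0 ∧ b⁻¹ ∈ T ∧ z = a / b)
    {z : K} (hz : z ∈ Subring.closure s) :
    ∃ a ∈ A, ∃ b ∈ A, b ≠ 0 ∧ b⁻¹ ∈ T ∧ z = a / b := by
  induction hz using Subring.closure_induction with
  | mem z hz => exact hs z hz
  | zero => exact frac_of_mem A.zero_mem
  | one => exact frac_of_mem A.one_mem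
  | add z w _ _ hz hw => exact frac_add hz hw
  | neg z _ hz => exact frac_neg hz
  | mul z w _ _ hz hw => exact frac_mul hz hw

/-- **Every member beyond `i₀` consists of fractions `a/b` over `R i₀` with `1/b ∈ T`**, for any subring
`T ⊇ ⋃ R i` containing `1/x`, `x ∈ R i₀` of positive value: the chart parameter `x_j` of each step has
`1/x_j = (x/x_j)·(1/x) ∈ T`. [cite: HeinzerEtAl2015, Thm. 4.1 (1) (proof, «isomorphism off the closed fibre»)]
[folklore] -/
theorem exists_frac_of_mem_member (O : ValuationSubring K) (R : ℕ → Subring K)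
    (hdom : SubringDominates (R 0) O.toSubring)
    (hstep : ∀ i, IsQuadraticTransformAlong O (R i) (R (i + 1)))
    (T : Subring K) (hST : ∀ i, R i ≤ T) {x : K} (hxT : x⁻¹ ∈ T) (hx0 : x ≠ 0)
    (hvx : O.valuation x < 1) (i₀ : ℕ) (hxi₀ : x ∈ R i₀) (d : ℕ) {z : K} (hz : z ∈ R (i₀ + d)) :
    ∃ a ∈ R i₀, ∃ b ∈ R i₀, b ≠ 0 ∧ b⁻¹ ∈ T ∧ z = a / b := by
  have hRdom : ∀ i, SubringDominates (R i) O.toSubring := fun i =>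
    (sequence_dominates hdom hstep i).1
  have hmono : Monotone R := sequence_monotone hstep
  induction d generalizing z with
  | zero => exact frac_of_mem hz
  | succ d ih =>
    obtain ⟨hloc, xj, hxjm, hxj0, -, hR⟩ := (hstep (i₀ + d)).exists_eq_locAtCentre
    have hmax : ∀ a : R (i₀ + d), a ∈ maximalIdeal (R (i₀ + d)) ↔ O.valuation (a : K) < 1 :=
      (subringDominates_valuationSubring_iff (hRdom _).1).mp (hRdom _)
    -- `x ∈ 𝔪_{i₀+d}`
    have hxj : x ∈ R (i₀ + d) := hmono (Nat.le_add_right _ _) hxi₀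
    have hxm : (⟨x, hxj⟩ : R (i₀ + d)) ∈ maximalIdeal (R (i₀ + d)) := (hmax _).mpr hvx
    -- the chart ring lies in the next member
    have hB_le : blowupRing (R (i₀ + d)) (xj : K) ≤ R (i₀ + d + 1) := by
      rw [hR]
      exact le_locAtCentre _ O
    have hxjK0 : ((xj : R (i₀ + d)) : K) ≠ 0 := fun h => hxj0 (Subtype.ext h)
    -- `1/x_j = (x/x_j)·(1/x) ∈ T`
    have hxjinvT : ((xj : R (i₀ + d)) : K)⁻¹ ∈ T := by
      have h1 : x / (xj : K) ∈ T := hST _ (hB_le (div_mem_blowupRing (xj : K) hxm))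
      have : ((xj : R (i₀ + d)) : K)⁻¹ = x / (xj : K) * x⁻¹ := by
        field_simp
      rw [this]
      exact T.mul_mem h1 hxT
    have hxjF := frac_inv (ih xj.2) hxjinvT
    -- the chart ring consists of such fractions
    have hB : ∀ w ∈ blowupRing (R (i₀ + d)) (xj : K),
        ∃ a ∈ R i₀, ∃ b ∈ R i₀, b ≠ 0 ∧ b⁻¹ ∈ T ∧ w = a / b := by
      intro w hw
      refine frac_of_mem_closure ?_ hw
      rintro w (hw | ⟨y, -, rfl⟩)
      · exact ih hw
      · dsimp only
        rw [div_eq_mul_inv]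
        exact frac_mul (ih y.2) hxjF
    -- `z = y / w` over the chart ring with `w` a unit of the next member
    have hz' : z ∈ R (i₀ + d + 1) := hz
    rw [hR, mem_locAtCentre_iff] at hz'
    obtain ⟨y, hy, w, hw, hvw, rfl⟩ := hz'
    have hwinv : w⁻¹ ∈ R (i₀ + d + 1) :=
      (hRdom (i₀ + d + 1)).2 w (hB_le hw)
        ((O.valuation_le_one_iff _).mp (by rw [map_inv₀, hvw, inv_one]))
    rw [div_eq_mul_inv]
    exact frac_mul (hB y hy) (frac_inv (hB w hw) (hST _ hwinv))

/-- **Every element of the hull `T = S[1/x]` is a fraction `a/b` over `R i₀` with `1/b ∈ T`.**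
[cite: HeinzerEtAl2015, Thm. 4.1 (1)] [folklore] -/
theorem exists_frac_of_mem_hull (O : ValuationSubring K) (R : ℕ → Subring K)
    (hdom : SubringDominates (R 0) O.toSubring)
    (hstep : ∀ i, IsQuadraticTransformAlong O (R i) (R (i + 1))) {x : K} (hx0 : x ≠ 0)
    (hvx : O.valuation x < 1) (i₀ : ℕ) (hxi₀ : x ∈ R i₀) {z : K}
    (hz : z ∈ Subring.closure (((⨆ i, R i : Subring K) : Set K) ∪ {x⁻¹})) :
    ∃ a ∈ R i₀, ∃ b ∈ R i₀, b ≠ 0 ∧ b⁻¹ ∈ Subring.closure (((⨆ i, R i : Subring K) : Set K) ∪ {x⁻¹}) ∧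
      z = a / b := by
  have hmono : Monotone R := sequence_monotone hstep
  have hST : ∀ i, R i ≤ Subring.closure (((⨆ i, R i : Subring K) : Set K) ∪ {x⁻¹}) := fun i z hz =>
    Subring.subset_closure (Or.inl (le_iSup R i hz))
  have hxT : x⁻¹ ∈ Subring.closure (((⨆ i, R i : Subring K) : Set K) ∪ {x⁻¹}) :=
    Subring.subset_closure (Or.inr rfl)
  refine frac_of_mem_closure ?_ hz
  rintro z (hz | rfl)
  · obtain ⟨j, hj⟩ := (Subring.mem_iSup_of_directed hmono.directed_le).mp hz
    exact exists_frac_of_mem_member O R hdom hstep _ hST hxT hx0 hvx i₀ hxi₀ j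
      (hmono (Nat.le_add_left j i₀) hj)
  · exact frac_inv (frac_of_mem hxi₀) hxT

/-- **`S[1/x]` is a localisation of the member `R i₀`** (the «Furthermore» clause of HLOST Thm. 4.1 (1), for
EVERY member containing `x`): with the inclusion algebra structure, `T = S[1/x]` is the localisation of `R i₀` at
the elements invertible in `T`. [cite: HeinzerEtAl2015, Thm. 4.1 (1)] -/
theorem isLocalization_hull (O : ValuationSubring K) (R : ℕ → Subring K)
    (hdom : SubringDominates (R 0) O.toSubring)
    (hstep : ∀ i, IsQuadraticTransformAlong O (R i) (R (i + 1))) {x : K} (hx0 : x ≠ 0)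
    (hvx : O.valuation x < 1) (i₀ : ℕ) (hxi₀ : x ∈ R i₀)
    (hle : R i₀ ≤ Subring.closure (((⨆ i, R i : Subring K) : Set K) ∪ {x⁻¹})) :
    letI := (Subring.inclusion hle).toAlgebra
    IsLocalization ((IsUnit.submonoid _).comap (Subring.inclusion hle))
      (Subring.closure (((⨆ i, R i : Subring K) : Set K) ∪ {x⁻¹})) := by
  letI := (Subring.inclusion hle).toAlgebra
  refine (isLocalization_iff _ _).mpr ⟨fun b => b.2, fun t => ?_, fun {a a'} h => ⟨1, by
    have : a = a' := Subring.inclusion_injective hle h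
    rw [this]⟩⟩
  obtain ⟨a, ha, b, hb, hb0, hbT, ht⟩ := exists_frac_of_mem_hull O R hdom hstep hx0 hvx i₀ hxi₀ t.2
  have hbu : IsUnit (Subring.inclusion hle ⟨b, hb⟩) :=
    isUnit_iff_exists_inv.mpr ⟨⟨b⁻¹, hbT⟩, Subtype.ext (mul_inv_cancel₀ hb0)⟩
  refine ⟨(⟨a, ha⟩, ⟨⟨b, hb⟩, hbu⟩), Subtype.ext ?_⟩
  show (t : K) * b = a
  rw [ht, div_mul_cancel₀ a hb0]

end ShannonHull

/-- **HLOST Theorem 4.1 (1), the clause «`T = S[1/x]` is a UFD» — PROVED** (discharges the named fact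
`HeinzerEtAl2015NoetherianHullUFD`): `S[1/x]` is a localisation of the regular local ring `R i₀ ∋ x`
(`ShannonHull.isLocalization_hull`), regular local rings are UFDs (Auslander–Buchsbaum, tree
`uniqueFactorizationMonoid_of_isRegularLocalRing`), and localisation preserves unique factorisation (Mathlib
`UniqueFactorizationMonoid.of_isLocalization`). The hypotheses «every member has dimension `≥ 2`» and «`xS` is
`N`-primary» of the fact are used only to exclude `x = 0`. [cite: HeinzerEtAl2015, Thm. 4.1 (1)] -/
theorem HeinzerEtAl2015NoetherianHullUFD_holds : HeinzerEtAl2015NoetherianHullUFD.{u} := by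
  intro K _ O R hreg _hdim hdom hstep x hxS hvx hprim
  classical
  have hRreg : ∀ i, IsRegularLocalRing (R i) := isRegularLocalRing_sequence hreg hstep
  have hRdom : ∀ i, SubringDominates (R i) O.toSubring := fun i =>
    (sequence_dominates hdom hstep i).1
  have hmono : Monotone R := sequence_monotone hstep
  obtain ⟨i₀, hxi₀⟩ := (Subring.mem_iSup_of_directed hmono.directed_le).mp hxS
  haveI := hRreg i₀
  -- `x ≠ 0`: a non-zero element of `𝔪_{i₀}` has a power in `x·S`
  have hx0 : x ≠ 0 := by
    obtain ⟨_, y, hym, hy0, -, -⟩ := (hstep i₀).exists_eq_locAtCentre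
    have hvy : O.valuation (y : K) < 1 :=
      ((subringDominates_valuationSubring_iff (hRdom i₀).1).mp (hRdom i₀) y).mp hym
    obtain ⟨m, s, -, hms⟩ := hprim (y : K) (le_iSup R i₀ y.2) hvy
    intro hx
    rw [hx, mul_zero] at hms
    rcases m with _ | m
    · exact one_ne_zero ((pow_zero (y : K)).symm.trans hms)
    · exact hy0 (Subtype.ext ((pow_eq_zero_iff (Nat.succ_ne_zero m)).mp hms))
  have hle : R i₀ ≤ Subring.closure (((⨆ i, R i : Subring K) : Set K) ∪ {x⁻¹}) := fun z hz =>
    Subring.subset_closure (Or.inl (le_iSup R i₀ hz))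
  letI := (Subring.inclusion hle).toAlgebra
  haveI := ShannonHull.isLocalization_hull O R hdom hstep hx0 hvx i₀ hxi₀ hle
  haveI : UniqueFactorizationMonoid (R i₀) := uniqueFactorizationMonoid_of_isRegularLocalRing _ (hRreg i₀)
  exact UniqueFactorizationMonoid.of_isLocalization ((IsUnit.submonoid _).comap (Subring.inclusion hle)) _

end Literature.AlgebraicGeometry.Resolution

end
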